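import Summits.BirchSwinnertonDyer.Rank1Residual.X11a.Cells
import Summits.BirchSwinnertonDyer.Rank1Residual.X11a.MainConjectureCertificates
import Literature.NumberTheory.EllipticCurves.Rank1Residual.X9SmallImage
import Literature.NumberTheory.EllipticCurves.Kato2004.Condition1252
import Summits.BirchSwinnertonDyer.Rank1Residual.X11b.MultiplicativeSurjectivity
import Literature.NumberTheory.EllipticCurves.Rank1Residual.X9NoEntry
import HarnessLib

/-!
# Leaf `ClassX11a` (cell `bsd-print-x11a`, seat p3 — the exceptional-zero / Euler-system road):
# the leaf in LOWER/UPPER-half currency — `X11a.Target` ⟺ (lower half on every pair) ∧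
# (Euler-system half on the NON-surjective pairs), and the unit-cell closing forms

HONEST FRAMING. THEOREMS ONLY (no definition, no named fact, no `sorry`); kernel re-plumbing of
published-fact consumers already in the tree; CONDITIONAL on the displayed binders; nothing is
booked by this file; the leaf `ClassX11a` (multiplicative odd `p`, `r_an = 0`, `E[p]` irreducible,
no (ram) witness — `Partition/Rows.lean`) stays OPEN at class level; BSD is not proved by any of
this. «beyond-print theorem: NO».

WHAT. The p3 strategy sentence of the cell («Kato divisibility at split multiplicative `p` +
Greenberg–Stevens 𝓛-invariant ⇒ r0 upper bound on `#Ш[p^∞]`; unit cells close») is, in print,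
Wuthrich's Prop. 21 (Doc. Math. 19 (2014); named fact `Wuthrich2014.sha_dvd_analyticSha`, PUB):
`ord_p #Ш(E/ℚ) ≤ ord_p #Ш(E/ℚ)_an` at every odd non-additive `p` with `ρ̄_{E,p}` surjective or Borel
(the exceptional zero and the 𝓛-invariant are inside the source's proof; tree consumers
`Typed.missingUpperBoundAt_of_wuthrich`, `Rank1Residual.bsdp_of_classX11_rankZero_surj_of_shaAn_unit`,
`X11a.CellPub.bsdp`, `X11a.CellThree.bsdp_of_surj_of_shaAnUnit`, `X11a.bsdp_iff_missingLowerBoundAt_of_surj`).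
This file states what that road leaves of the WHOLE leaf, uniformly in `p` (`p = 3` included), in
the half-currency of `Rank1Residual/Typed/Basic.lean` — `Typed.MissingLowerBoundAt W p`
(`ord_p #Ш_an ≤ ord_p #Ш`, the main-conjecture half) and `Typed.MissingUpperBoundAt W p`
(`ord_p #Ш ≤ ord_p #Ш_an`, the Euler-system half):

* `x11a_bsdp_of_lowerBound_of_nonSurjUpperBound` — at ONE pair: `BSD(E,p)` ⇐ the lower half +
  (the upper half if `ρ̄_{E,p}` is not onto); the upper half at a surjective image is Prop. 21.
* `x11aTarget_iff_lowerHalf_and_nonSurjEulerHalf` — **the leaf target `X11a.Target` is EQUIVALENT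
  to the conjunction of two displayed inputs**: (L) the lower half at every X11a pair — verbatim the
  body of crux `stmt-BirchSwinnertonDyer-19064` (`Theses.ErratumRoadFive.X11aLowerHalf`, rung K6 ∕
  barrier B3's object) — and (U) the Euler-system half at every NON-surjective X11a pair (irreducible
  image `3Ns/3Nn/5Ns/5S4/7Ns`, `p ∈ {3,5,7}`, `p ∣ v_p(Δ_min)`; not in print class-wide: Wuthrich's
  constant `C` may contain such `p`, Kato's (12.5.2) asks for a big image; per pair it is a
  Heegner-index (Cha 2005 Thm. 21) or `p`-descent certificate). Neither input is weaker or stronger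
  than needed. No route file is imported, so a route's `closes` may cite these theorems.
* `x11a_integralityBinders_refuted_of_not_surj` — WHY (U) is not in print class-wide: at a
  non-surjective X11a pair every integrality binder of the tree's Euler-system facts is REFUTED —
  `∀ n, Surj(p^n)` (Kato 17.4 (3) / Wuthrich Cor. 19 binder), Kato's (12.5.2)
  (`Kato2004.ImageContainsSL2`), and (im) (`BigIm`, Burungale–Castella–Skinner / Skinner 2016 §2.5 (b))
  — all by tree theorems (`Kato2004.not_imageContainsSL2_of_not_hasSurjectiveModNGaloisRep`,
  `Rank1Residual.not_bigIm_of_irr_of_not_surj`).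
* unit cells: `x11a_missingLowerBoundAt_of_shaAnUnit` (on `ord_p #Ш_an = 0` the lower half is
  trivial), `x11a_bsdp_of_not_surj_of_shaAnUnit_of_upperBound` (a non-surjective UNIT cell needs the
  Euler-system half only), and `x11aTarget_iff_lowerHalf_offUnit_and_nonSurjEulerHalf` (the lower
  half is only ever needed OFF the unit cells).

Companion of the cell's discharge interface `X11a/PrintDischarge.lean` (seat ty2; its
`ClassX11a.bsdp_of_halves` is the one-pair form "both halves ⇒ `BSDp`", not restated here) and of
`X11a.bsdp_iff_missingLowerBoundAt_of_surj` (MainConjectureCertificates).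

Binders (PUBLISHED named facts, as in `X11a/Cells.lean`): `hWu` = Wuthrich 2014 Prop. 21
(`sha_dvd_analyticSha`), `hGZK` = Gross–Zagier–Kolyvagin (`rank_eq_analyticRank_of_analyticRank_le_one`),
`hmod` = modularity / entire `L`-function (`hasEntireLFunction_rat`).

References: [Wuthrich2014] Prop. 21 (p. 400); [Miller2011LMS] §1, Def. 1.1; [Cha2005] Thm. 21
(p. 173); [Kato2004Asterisque] Thm. 14.5 (3), (12.5.2); cell records
`pub/bsd-print-x11a/STATUS.md` (p3 13:40Z), `pub/pub-bsdres/class-closure/N7/SUBPARTITION.md`.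
-/

noncomputable section

open scoped Classical

open WeierstrassCurve Literature.NumberTheory.EllipticCurves
  Literature.NumberTheory.EllipticCurves.Rank1Residual
  Literature.NumberTheory.EllipticCurves.Rank1Residual.Typed
  Literature.NumberTheory.EllipticCurves.Wuthrich2014
  Summit.BirchSwinnertonDyer.Rank1Residual Summit.BirchSwinnertonDyer.Rank1Residual.X11a

set_option autoImplicit false
-- the cell's Theorems namespace repeats the summit name (Summit.<Summit>.<Problem>), as in every sibling file
set_option linter.dupNamespace false

namespace Summit.BirchSwinnertonDyer.BirchSwinnertonDyer.Theorems

variable {W : WeierstrassCurve ℚ} [W.IsElliptic] [W.IsGloballyMinimal] {p : ℕ} [Fact p.Prime]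

/-! ### One pair -/

omit [W.IsElliptic] [W.IsGloballyMinimal] [Fact p.Prime] in
/-- On a UNIT cell (`#Ш(E/ℚ)_an` a rational `p`-adic unit, `ShaAnUnit W p`) the main-conjecture
half `ord_p #Ш_an ≤ ord_p #Ш` is trivial (`0 ≤` a natural number). [cite: Miller2011LMS, §1 and Def. 1.1] -/
theorem x11a_missingLowerBoundAt_of_shaAnUnit (h : ShaAnUnit W p) : MissingLowerBoundAt W p := by
  obtain ⟨q, hq, hv⟩ := h
  exact ⟨q, hq, by rw [hv]; exact_mod_cast Nat.zero_le _⟩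

/-- **`BSD(E,p)` at an X11a pair from the lower half, plus the Euler-system half when `ρ̄_{E,p}` is
NOT onto.** At a surjective image the upper half is Wuthrich 2014 Prop. 21 (`hWu`; tree
`X11a.bsdp_iff_missingLowerBoundAt_of_surj`, every odd `p`). [cite: Wuthrich2014, Prop. 21 (p. 400)]
[cite: Miller2011LMS, §1 and Def. 1.1] -/
theorem x11a_bsdp_of_lowerBound_of_nonSurjUpperBound (hWu : sha_dvd_analyticSha)
    (hGZK : rank_eq_analyticRank_of_analyticRank_le_one) (hmod : hasEntireLFunction_rat)
    (hX : ClassX11a W p) (hl : MissingLowerBoundAt W p)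
    (hu : ¬ Surj W p → MissingUpperBoundAt W p) : BSDp W p := by
  by_cases hsurj : Surj W p
  · exact (X11a.bsdp_iff_missingLowerBoundAt_of_surj hWu hGZK hmod hX hsurj).mpr hl
  · exact bsdp_of_missingPPartAt W p hGZK (by rw [hX.analyticRank_eq_zero]; exact zero_le_one)
        (missingPPartAt_of_lower_of_upper W p hl (hu hsurj))

/-- **A NON-surjective UNIT cell needs the Euler-system half only**: `(E,p) ∈ X11a`, `ρ̄_{E,p}` not
onto, `ord_p #Ш(E/ℚ)_an = 0`, and `ord_p #Ш ≤ ord_p #Ш_an` ⇒ `BSD(E,p)`. (Per pair the last binder is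
a Heegner-index certificate, Cha 2005 Thm. 21 — `p ‖ N` allowed —, or an exact `p`-descent,
`X11a.Leaf.bsdp_of_card_selmerGroup_eq_one`; class-wide it is not in print.) The surjectivity
failure is not used in the proof; it is displayed because at a surjective image the binder `hu` is a
theorem (`Typed.missingUpperBoundAt_of_wuthrich`). [cite: Miller2011LMS, §1 and Def. 1.1]
[cite: Cha2005, Thm. 21 (p. 173)] -/
theorem x11a_bsdp_of_not_surj_of_shaAnUnit_of_upperBound
    (hGZK : rank_eq_analyticRank_of_analyticRank_le_one) (hX : ClassX11a W p) (_hns : ¬ Surj W p)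
    (hunit : ShaAnUnit W p) (hu : MissingUpperBoundAt W p) : BSDp W p :=
  bsdp_of_missingPPartAt W p hGZK (by rw [hX.analyticRank_eq_zero]; exact zero_le_one)
    (missingPPartAt_of_lower_of_upper W p (x11a_missingLowerBoundAt_of_shaAnUnit hunit) hu)

/-- Conversely `BSD(E,p)` at an X11a pair gives both halves (`Ш` finite by `hGZK`). Bookkeeping.
[cite: Miller2011LMS, Def. 1.1] -/
theorem x11a_lower_and_upper_of_bsdp (hGZK : rank_eq_analyticRank_of_analyticRank_le_one)
    (hX : ClassX11a W p) (h : BSDp W p) : MissingLowerBoundAt W p ∧ MissingUpperBoundAt W p := by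
  haveI : Finite W.sha := (hGZK W (by rw [hX.analyticRank_eq_zero]; exact zero_le_one)).2
  exact lower_and_upper_of_missingPPartAt W p (missingPPartAt_of_bsdp W p h)

/-! ### Why the Euler-system half is not in print at a non-surjective X11a pair -/

/-- **On a NON-surjective X11a pair the three integrality binders of the tree's Euler-system facts
all FAIL**: (a) `ρ̄_{E,p^n}` onto for every `n` (binder of `kato_divisibility` (3) and of
`Wuthrich2014.kato_charIdeal_dvd_multiplicative_of_surjective`) — already at `n = 1`;
(b) Kato's (12.5.2) "the image of `Gal(ℚ̄/ℚ(ζ_{p^∞}))` contains `SL₂(ℤ_p)`"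
(`Kato2004.ImageContainsSL2`, Astérisque 295 Thm. 12.5 (4)); (c) (im) "some `σ ∈ G_{ℚ(μ_{p^∞})}`
with `T_pE/(σ−1)T_pE ≅ ℤ_p`" (`BigIm`; Burungale–Castella–Skinner 2025, Skinner 2016 §2.5 (b)) —
such a `σ` would be a transvection of order `p` in an irreducible proper image (Serre). Hence no
integral Kato-type bound in the tree reaches these pairs; the upper half there is per pair
(Cha 2005 Thm. 21, descent) or open. [cite: Kato2004Asterisque, (12.5.2) in Thm. 12.5 (4) (p. 222)]
[cite: BurungaleCastellaSkinner2025, p. 2, hypothesis (im)] -/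
theorem x11a_integralityBinders_refuted_of_not_surj (hX : ClassX11a W p) (hns : ¬ Surj W p) :
    ¬ (∀ n : ℕ, W.HasSurjectiveModNGaloisRep (p ^ n : ℕ)) ∧
      ¬ Kato2004.ImageContainsSL2 W p ∧ ¬ BigIm W p := by
  refine ⟨fun h => hns ?_, Kato2004.not_imageContainsSL2_of_not_hasSurjectiveModNGaloisRep W p hns,
    not_bigIm_of_irr_of_not_surj W p hX.irr hns⟩
  simpa using h 1

/-! ### The whole leaf: `X11a.Target` in half-currency -/

/-- **The X11a leaf target from two displayed inputs**: (L) the main-conjecture half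
`ord_p #Ш_an ≤ ord_p #Ш` at EVERY X11a pair — verbatim the body of crux `stmt-BirchSwinnertonDyer-19064`
`ErratumRoadFive.X11aLowerHalf` — and (U) the Euler-system half `ord_p #Ш ≤ ord_p #Ш_an` at every
NON-surjective X11a pair. Published binders: Wuthrich Prop. 21, GZK, modularity.
[cite: Wuthrich2014, Prop. 21 (p. 400)] [cite: Miller2011LMS, §1 and Def. 1.1] -/
theorem x11aTarget_of_lowerHalf_of_nonSurjEulerHalf (hWu : sha_dvd_analyticSha)
    (hGZK : rank_eq_analyticRank_of_analyticRank_le_one) (hmod : hasEntireLFunction_rat)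
    (hL : ∀ (W : WeierstrassCurve ℚ) [W.IsElliptic] [W.IsGloballyMinimal] (p : ℕ) [Fact p.Prime],
      ClassX11a W p → MissingLowerBoundAt W p)
    (hU : ∀ (W : WeierstrassCurve ℚ) [W.IsElliptic] [W.IsGloballyMinimal] (p : ℕ) [Fact p.Prime],
      ClassX11a W p → ¬ Surj W p → MissingUpperBoundAt W p) :
    X11a.Target :=
  fun W _ _ p _ _ hX =>
    x11a_bsdp_of_lowerBound_of_nonSurjUpperBound hWu hGZK hmod hX (hL W p hX) (hU W p hX)

/-- The same with the lower half asked only OFF the unit cells (`¬ ShaAnUnit W p`, i.e. not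
[`#Ш_an` a rational `p`-adic unit]); on a unit cell it is automatic
(`x11a_missingLowerBoundAt_of_shaAnUnit`). [cite: Wuthrich2014, Prop. 21 (p. 400)]
[cite: Miller2011LMS, §1 and Def. 1.1] -/
theorem x11aTarget_of_lowerHalf_offUnit_of_nonSurjEulerHalf (hWu : sha_dvd_analyticSha)
    (hGZK : rank_eq_analyticRank_of_analyticRank_le_one) (hmod : hasEntireLFunction_rat)
    (hL : ∀ (W : WeierstrassCurve ℚ) [W.IsElliptic] [W.IsGloballyMinimal] (p : ℕ) [Fact p.Prime],
      ClassX11a W p → ¬ ShaAnUnit W p → MissingLowerBoundAt W p)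
    (hU : ∀ (W : WeierstrassCurve ℚ) [W.IsElliptic] [W.IsGloballyMinimal] (p : ℕ) [Fact p.Prime],
      ClassX11a W p → ¬ Surj W p → MissingUpperBoundAt W p) :
    X11a.Target := by
  refine x11aTarget_of_lowerHalf_of_nonSurjEulerHalf hWu hGZK hmod (fun W _ _ p _ hX => ?_) hU
  by_cases hunit : ShaAnUnit W p
  · exact x11a_missingLowerBoundAt_of_shaAnUnit hunit
  · exact hL W p hX hunit

/-- **Exactness: the two displayed inputs are EQUIVALENT to the leaf target** — given Wuthrich
Prop. 21, GZK and modularity, `X11a.Target` holds iff (L) the main-conjecture half holds at every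
X11a pair and (U) the Euler-system half holds at every non-surjective X11a pair. So (L) = crux 19064
and (U) are neither weaker nor stronger than what the leaf needs on this road.
[cite: Wuthrich2014, Prop. 21 (p. 400)] [cite: Miller2011LMS, §1 and Def. 1.1] -/
theorem x11aTarget_iff_lowerHalf_and_nonSurjEulerHalf (hWu : sha_dvd_analyticSha)
    (hGZK : rank_eq_analyticRank_of_analyticRank_le_one) (hmod : hasEntireLFunction_rat) :
    X11a.Target ↔
      (∀ (W : WeierstrassCurve ℚ) [W.IsElliptic] [W.IsGloballyMinimal] (p : ℕ) [Fact p.Prime],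
          ClassX11a W p → MissingLowerBoundAt W p) ∧
        (∀ (W : WeierstrassCurve ℚ) [W.IsElliptic] [W.IsGloballyMinimal] (p : ℕ) [Fact p.Prime],
          ClassX11a W p → ¬ Surj W p → MissingUpperBoundAt W p) := by
  constructor
  · intro hT
    refine ⟨fun W _ _ p _ hX => ?_, fun W _ _ p _ hX _ => ?_⟩
    · exact (x11a_lower_and_upper_of_bsdp hGZK hX
        (hT W p (by rw [hX.analyticRank_eq_zero]; exact zero_le_one) hX)).1
    · exact (x11a_lower_and_upper_of_bsdp hGZK hX
        (hT W p (by rw [hX.analyticRank_eq_zero]; exact zero_le_one) hX)).2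
  · rintro ⟨hL, hU⟩
    exact x11aTarget_of_lowerHalf_of_nonSurjEulerHalf hWu hGZK hmod hL hU

/-- Exactness in the off-unit form: `X11a.Target` iff (L′) the main-conjecture half off the unit
cells and (U) the Euler-system half at the non-surjective pairs. [cite: Wuthrich2014, Prop. 21 (p. 400)]
[cite: Miller2011LMS, §1 and Def. 1.1] -/
theorem x11aTarget_iff_lowerHalf_offUnit_and_nonSurjEulerHalf (hWu : sha_dvd_analyticSha)
    (hGZK : rank_eq_analyticRank_of_analyticRank_le_one) (hmod : hasEntireLFunction_rat) :
    X11a.Target ↔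
      (∀ (W : WeierstrassCurve ℚ) [W.IsElliptic] [W.IsGloballyMinimal] (p : ℕ) [Fact p.Prime],
          ClassX11a W p → ¬ ShaAnUnit W p → MissingLowerBoundAt W p) ∧
        (∀ (W : WeierstrassCurve ℚ) [W.IsElliptic] [W.IsGloballyMinimal] (p : ℕ) [Fact p.Prime],
          ClassX11a W p → ¬ Surj W p → MissingUpperBoundAt W p) := by
  rw [x11aTarget_iff_lowerHalf_and_nonSurjEulerHalf hWu hGZK hmod]
  constructor
  · rintro ⟨hL, hU⟩
    exact ⟨fun W _ _ p _ hX _ => hL W p hX, hU⟩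
  · rintro ⟨hL, hU⟩
    refine ⟨fun W _ _ p _ hX => ?_, hU⟩
    by_cases hunit : ShaAnUnit W p
    · exact x11a_missingLowerBoundAt_of_shaAnUnit hunit
    · exact hL W p hX hunit

/-- The leaf in the PARTITION's own shape (no `r_an ≤ 1` binder): every X11a pair satisfies
`BSD(E,p)`, from (L) and (U). [cite: Wuthrich2014, Prop. 21 (p. 400)] [cite: Miller2011LMS, §1 and Def. 1.1] -/
theorem forall_classX11a_bsdp_of_lowerHalf_of_nonSurjEulerHalf (hWu : sha_dvd_analyticSha)
    (hGZK : rank_eq_analyticRank_of_analyticRank_le_one) (hmod : hasEntireLFunction_rat)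
    (hL : ∀ (W : WeierstrassCurve ℚ) [W.IsElliptic] [W.IsGloballyMinimal] (p : ℕ) [Fact p.Prime],
      ClassX11a W p → MissingLowerBoundAt W p)
    (hU : ∀ (W : WeierstrassCurve ℚ) [W.IsElliptic] [W.IsGloballyMinimal] (p : ℕ) [Fact p.Prime],
      ClassX11a W p → ¬ Surj W p → MissingUpperBoundAt W p)
    (W : WeierstrassCurve ℚ) [W.IsElliptic] [W.IsGloballyMinimal] (p : ℕ) [Fact p.Prime]
    (hX : ClassX11a W p) : BSDp W p :=
  x11a_bsdp_of_lowerBound_of_nonSurjUpperBound hWu hGZK hmod hX (hL W p hX) (hU W p hX)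

end Summit.BirchSwinnertonDyer.BirchSwinnertonDyer.Theorems

end

/-! ## Appendix (same seat, same day): the residual (U) on its explicit LOCUS

The planner may file the Euler-system residual on the locus form used by the K2 route's
`NonSurjCorner` (`p ∈ {5,7} ∧ p ∣ v_p(Δ_min)`), rather than on the image bit `¬ Surj W p`. On the
rank-0 leaf the locus is `p ∈ {3, 5, 7} ∧ p ∣ v_p(Δ_min) ∧ ¬ Semistable` — `p = 3` INCLUDED
(images `3Ns`/`3Nn`; most N7 cells of record sit there) — by three tree theorems: Balakrishnan et
al. 2019 Thm. 1.2 ⇒ `p < 11` (`GaloisImage.eq_five_or_eq_seven_of_mult_of_irr_of_not_surj`, named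
fact `hB`), Tate's transvection ⇒ `p ∣ v_p(Δ_min)` (`ClassX11a.surj_of_not_dvd`), Serre 1972 Prop. 21
⇒ non-semistable (`Rank1Residual.surj_of_irr_of_semistable`). The discharge interface's
`ClassX11a.not_surj_shape` (X11a/PrintDischarge.lean) is the `p ≥ 5` case; the lemma below is
uniform in `p`. -/

noncomputable section

-- as above: the Theorems namespace repeats the summit name
set_option linter.dupNamespace false

namespace Summit.BirchSwinnertonDyer.BirchSwinnertonDyer.Theorems

open WeierstrassCurve Literature.NumberTheory.EllipticCurves
  Literature.NumberTheory.EllipticCurves.Rank1Residual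
  Literature.NumberTheory.EllipticCurves.Rank1Residual.Typed
  Literature.NumberTheory.EllipticCurves.Wuthrich2014
  Literature.NumberTheory.EllipticCurves.BalakrishnanEtAl2019
  Summit.BirchSwinnertonDyer.Rank1Residual Summit.BirchSwinnertonDyer.Rank1Residual.X11a

variable {W : WeierstrassCurve ℚ} [W.IsElliptic] [W.IsGloballyMinimal] {p : ℕ} [Fact p.Prime]

/-- **The LOCUS of the non-surjective X11a pairs, uniformly in `p`**: if `(E,p) ∈ X11a` and
`ρ̄_{E,p}` is not onto then `p ∈ {3, 5, 7}`, `p ∣ v_p(Δ_min)` (peu ramifié: otherwise inertia at the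
multiplicative prime `p` supplies a transvection) and `E` is not semistable (Serre: irreducible ⇒
onto for semistable curves). Named fact `hB` = Balakrishnan–Dogra–Müller–Tuitman–Vonk 2019 Thm. 1.2
(no exceptional split-Cartan points at `p = 13`), used through the tree's `p ≥ 11 ⇒ onto`.
[cite: BalakrishnanEtAl2019, §1 Thm. 1.2 (arXiv:1711.05846 p. 2)]
[cite: SilvermanATAEC1994, V.6 Prop. 6.1 (p. 410)] [cite: Serre1972, §5.4 Prop. 21 i)] -/
theorem x11a_not_surj_locus (hB : thm12_not_le_normalizer_splitCartan) (hX : ClassX11a W p)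
    (hns : ¬ Surj W p) :
    (p = 3 ∨ p = 5 ∨ p = 7) ∧ p ∣ padicValInt p W.minimalDiscriminantInt ∧ ¬ Semistable W := by
  have hpP : p.Prime := Fact.out
  refine ⟨?_, by_contra fun h => hns (ClassX11a.surj_of_not_dvd W p hX h),
    fun h => hns (surj_of_irr_of_semistable W p hX.irr h)⟩
  by_cases h3 : p = 3
  · exact Or.inl h3
  · have h2 : p ≠ 2 := hX.ne_two
    have h5 : 5 ≤ p := by
      have h2le := hpP.two_le
      have h4 : p ≠ 4 := fun h => by rw [h] at hpP; exact absurd hpP (by decide)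
      omega
    exact Or.inr (GaloisImage.eq_five_or_eq_seven_of_mult_of_irr_of_not_surj W p hB h5 hX.mult
      hX.irr hns)

/-- **The leaf target with the Euler-system residual asked only on its explicit locus**
`p ∈ {3,5,7} ∧ p ∣ v_p(Δ_min) ∧ ¬ Semistable` (plus the image bit): together with (L) = the body of
crux 19064 it gives `X11a.Target`. [cite: Wuthrich2014, Prop. 21 (p. 400)]
[cite: BalakrishnanEtAl2019, §1 Thm. 1.2 (arXiv:1711.05846 p. 2)] [cite: Miller2011LMS, §1 and Def. 1.1] -/
theorem x11aTarget_of_lowerHalf_of_eulerHalfOnLocus (hB : thm12_not_le_normalizer_splitCartan)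
    (hWu : sha_dvd_analyticSha) (hGZK : rank_eq_analyticRank_of_analyticRank_le_one)
    (hmod : hasEntireLFunction_rat)
    (hL : ∀ (W : WeierstrassCurve ℚ) [W.IsElliptic] [W.IsGloballyMinimal] (p : ℕ) [Fact p.Prime],
      ClassX11a W p → MissingLowerBoundAt W p)
    (hU : ∀ (W : WeierstrassCurve ℚ) [W.IsElliptic] [W.IsGloballyMinimal] (p : ℕ) [Fact p.Prime],
      ClassX11a W p → ¬ Surj W p → (p = 3 ∨ p = 5 ∨ p = 7) →
        p ∣ padicValInt p W.minimalDiscriminantInt → ¬ Semistable W → MissingUpperBoundAt W p) :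
    X11a.Target :=
  x11aTarget_of_lowerHalf_of_nonSurjEulerHalf hWu hGZK hmod hL fun W _ _ p _ hX hns =>
    have h := x11a_not_surj_locus hB hX hns
    hU W p hX hns h.1 h.2.1 h.2.2

/-- Exactness in the locus form: `X11a.Target` iff (L) and (U-on-the-locus).
[cite: Wuthrich2014, Prop. 21 (p. 400)] [cite: BalakrishnanEtAl2019, §1 Thm. 1.2 (arXiv:1711.05846 p. 2)]
[cite: Miller2011LMS, §1 and Def. 1.1] -/
theorem x11aTarget_iff_lowerHalf_and_eulerHalfOnLocus (hB : thm12_not_le_normalizer_splitCartan)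
    (hWu : sha_dvd_analyticSha) (hGZK : rank_eq_analyticRank_of_analyticRank_le_one)
    (hmod : hasEntireLFunction_rat) :
    X11a.Target ↔
      (∀ (W : WeierstrassCurve ℚ) [W.IsElliptic] [W.IsGloballyMinimal] (p : ℕ) [Fact p.Prime],
          ClassX11a W p → MissingLowerBoundAt W p) ∧
        (∀ (W : WeierstrassCurve ℚ) [W.IsElliptic] [W.IsGloballyMinimal] (p : ℕ) [Fact p.Prime],
          ClassX11a W p → ¬ Surj W p → (p = 3 ∨ p = 5 ∨ p = 7) →
            p ∣ padicValInt p W.minimalDiscriminantInt → ¬ Semistable W →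
              MissingUpperBoundAt W p) := by
  constructor
  · intro hT
    obtain ⟨hL, hU⟩ := (x11aTarget_iff_lowerHalf_and_nonSurjEulerHalf hWu hGZK hmod).mp hT
    exact ⟨hL, fun W _ _ p _ hX hns _ _ _ => hU W p hX hns⟩
  · rintro ⟨hL, hU⟩
    exact x11aTarget_of_lowerHalf_of_eulerHalfOnLocus hB hWu hGZK hmod hL hU

end Summit.BirchSwinnertonDyer.BirchSwinnertonDyer.Theorems

end
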